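import Summits.FinalStateConjecture.FinalStateConjecture.Theorems.PhaseMixingCaptureBulkKerrCaptureC2ReflectionData
import Mathlib.MeasureTheory.Measure.Haar.InnerProductSpace
import HarnessLib

/-!
# Crux `PhaseMixingCapture.BulkKerrCaptureC2` (stmt-FinalStateConjecture-14985): SPIN REVERSAL — the weighted Sobolev
# data distance is invariant under the reflection of the slice

Support file for the crux `BulkKerrCaptureC2`, sequel of `…ReflectionData`.  The hypotheses of the crux's matrix
`CaptureC2At s δ M _ ε η a` are phrased in the weighted Sobolev distance `dist_{s,δ}(D₁, D₂) = ‖h₁ − h₂‖_{H^s_δ(U)} +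
‖k₁ − k₂‖_{H^{s−1}_{δ+1}(U)}` of the Cartesian components on the slice `U = Kerr.slice a M ⊆ ℝ³`
(`InitialDataSet.dataWeightedSobolevEDist`, Bartnik 1986, (1.2); Christodoulou–Klainerman 1993, (1.0.9)).  A Euclidean
linear isometry `L₃` of `ℝ³` preserves the weights `(1 + ‖y‖)^{2(δ+m)}`, Lebesgue measure and the norms of all iterated
derivatives, so pulling two data back along the reflection of the slice does not change their distance:

* §1 `weightedSobolevSeminorm_comp_isometry` — for a Euclidean linear isometry `L` of `ℝ³`, a linear isometry `Φ` of
  the coefficient space and sets `y ∈ U ↔ L y ∈ V`:  `‖Φ ∘ f ∘ L‖_{H^s_δ(U)} = ‖f‖_{H^s_δ(V)}`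
  (`LinearIsometryEquiv.norm_iteratedFDeriv_comp_left/right`, `LinearIsometryEquiv.measurePreserving`);
* §2 **`dataWeightedSobolevEDist_comap_sliceReflect`** — for the slice reflection `F : Kerr.slice b r₀ ≃ₜ Kerr.slice a r₀`
  (`b = −a`, `F = L₃` in coordinates): `dist_{s,δ}(F^* D₁, F^* D₂) = dist_{s,δ}(D₁, D₂)` for all data `D₁, D₂` on
  `Kerr.slice a r₀` (the component differences of the pull-backs are `(h₁ − h₂)(L₃ ·)(L₃ ·, L₃ ·)`,
  `hFun_comap_sliceReflect`, `kFun_comap_sliceReflect`); with `comap_sliceReflect_kerrData` this carries b-conormality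
  and `ε`-closeness to `Kerr.data M a M` over to the reflected datum and `Kerr.data M (−a) M`, with the SAME `ε`.

Everything is proved; no definitions, no named facts.  References: R. Bartnik, CPAM 39 (1986), (1.2)–(1.3);
D. Christodoulou, S. Klainerman (1993), (1.0.9); R. Bartnik, J. Isenberg (2004), §2.
-/

-- the doubled `FinalStateConjecture.FinalStateConjecture` path component trips dupNamespace
set_option linter.dupNamespace false

noncomputable section

-- instance search through the nested operator type `E3 →L[ℝ] E3 →L[ℝ] ℝ` (as in the tree files)
set_option maxSynthPendingDepth 3

open Set Function Topology MeasureTheory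
open scoped Manifold ContDiff Topology
open Literature.Geometry.Lorentzian

namespace Summit.FinalStateConjecture.FinalStateConjecture.Theorems.BulkKerrCaptureC2.Reflection

/-! ## §1 Weighted Sobolev seminorms under a Euclidean linear isometry -/

section Seminorm

variable {G : Type*} [NormedAddCommGroup G] [NormedSpace ℝ G]

/-- **Weighted Sobolev seminorms are invariant under Euclidean linear isometries**: for a linear isometry `L` of `ℝ³`,
a linear isometry `Φ` of the coefficient space and sets with `y ∈ U ↔ L y ∈ V` (`V` measurable),
`‖Φ ∘ f ∘ L‖_{H^s_δ(U)} = ‖f‖_{H^s_δ(V)}` — the weight `(1 + ‖y‖)^{2(δ+m)}` is `L`-invariant, `‖Dᵐ(Φ ∘ f ∘ L)(y)‖ =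
‖Dᵐ f (L y)‖` (composition with linear isometric equivalences on either side, no differentiability needed), and `L`
preserves Lebesgue measure.  Bartnik 1986, (1.2). [cite: Bartnik1986, (1.2)] -/
theorem weightedSobolevSeminorm_comp_isometry (L : E3 ≃ₗᵢ[ℝ] E3) (Φ : G ≃ₗᵢ[ℝ] G) {U V : Set E3}
    (hV : MeasurableSet V) (hUV : ∀ y, y ∈ U ↔ L y ∈ V) (s : ℕ) (δ : ℝ) (f : E3 → G) :
    weightedSobolevSeminorm U s δ (Φ ∘ f ∘ L) = weightedSobolevSeminorm V s δ f := by
  have hU : U = L ⁻¹' V := Set.ext fun y ↦ hUV y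
  subst hU
  have _ := hV
  unfold weightedSobolevSeminorm
  congr 1
  refine Finset.sum_congr rfl fun m _ ↦ ?_
  have hmeas : MeasurableEmbedding L := L.toHomeomorph.measurableEmbedding
  rw [← L.measurePreserving.setLIntegral_comp_preimage_emb hmeas
    (fun y ↦ ENNReal.ofReal ((1 + ‖y‖) ^ (2 * (δ + m) : ℝ) * ‖iteratedFDeriv ℝ m f y‖ ^ 2)) V]
  refine lintegral_congr fun x ↦ ?_
  rw [Φ.norm_iteratedFDeriv_comp_left, L.norm_iteratedFDeriv_comp_right, L.norm_map]

end Seminorm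

/-! ## §2 The data distance of two pull-backs along the reflection of the slice -/

section Distance

variable {L : E4 ≃ₗᵢ[ℝ] E4} (hL : ∀ (x : E4) (i : Fin 4), L x i = if i = 2 then -x i else x i)
  {L₃ : E3 ≃ₗᵢ[ℝ] E3} (hL₃ : ∀ (y : E3) (i : Fin 3), L₃ y i = if i = 1 then -y i else y i)
  {a b r₀ : ℝ} {F : Kerr.slice b r₀ ≃ₜ Kerr.slice a r₀} (hF : ∀ y, ((F y : Kerr.slice a r₀) : E3) = L₃ y)
include hL hL₃ hF

/-- **The weighted Sobolev data distance is invariant under the reflection of the slice**: for the slice reflection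
`F : Kerr.slice b r₀ ≃ₜ Kerr.slice a r₀`, `b = −a`, and any two data `D₁, D₂` on `Kerr.slice a r₀`,
`dist_{s,δ}(F^* D₁, F^* D₂) = dist_{s,δ}(D₁, D₂)`: the component differences of the pull-backs are
`Φ₃ ∘ (h₁ − h₂) ∘ L₃`, `Φ₃ ∘ (k₁ − k₂) ∘ L₃` for the isometry `Φ₃ A = A(L₃ ·, L₃ ·)` of bilinear forms
(`hFun_comap_sliceReflect`, `kFun_comap_sliceReflect`), and `weightedSobolevSeminorm_comp_isometry` applies with
`y ∈ Kerr.slice b r₀ ↔ L₃ y ∈ Kerr.slice a r₀`.  Bartnik 1986, (1.2); Bartnik–Isenberg 2004, §2. [cite: Bartnik1986, (1.2)] -/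
theorem dataWeightedSobolevEDist_comap_sliceReflect (hba : b = -a) (hFc : ContMDiff (𝓡 3) (𝓡 3) (∞ + 1) F)
    (hFi : ∀ u, Injective (mfderiv (𝓡 3) (𝓡 3) F u)) (s : ℕ) (δ : ℝ)
    (D₁ D₂ : InitialDataSet 𝓘(ℝ, E3) (Kerr.slice a r₀)) :
    InitialDataSet.dataWeightedSobolevEDist s δ (D₁.comap F hFc hFi) (D₂.comap F hFc hFi) =
      InitialDataSet.dataWeightedSobolevEDist s δ D₁ D₂ := by
  obtain ⟨Φ₃, hΦ₃⟩ := exists_bilinearCompIsometry (F := E3) L₃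
  have hV : MeasurableSet ((Kerr.slice a r₀ : TopologicalSpace.Opens E3) : Set E3) :=
    (Kerr.slice a r₀).isOpen.measurableSet
  have hUV : ∀ y : E3, y ∈ ((Kerr.slice b r₀ : TopologicalSpace.Opens E3) : Set E3) ↔
      L₃ y ∈ ((Kerr.slice a r₀ : TopologicalSpace.Opens E3) : Set E3) := fun y ↦ by
    subst hba
    exact (reflect₃_mem_slice_iff hL hL₃).symm
  have hh : (D₁.comap F hFc hFi).hFun - (D₂.comap F hFc hFi).hFun = Φ₃ ∘ (D₁.hFun - D₂.hFun) ∘ L₃ := by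
    funext y
    simp only [Pi.sub_apply, comp_apply, hFun_comap_sliceReflect hL hL₃ hF hFc hFi hΦ₃ hba, map_sub]
  have hk : (D₁.comap F hFc hFi).kFun - (D₂.comap F hFc hFi).kFun = Φ₃ ∘ (D₁.kFun - D₂.kFun) ∘ L₃ := by
    funext y
    simp only [Pi.sub_apply, comp_apply, kFun_comap_sliceReflect hL hL₃ hF hFc hFi hΦ₃ hba, map_sub]
  unfold InitialDataSet.dataWeightedSobolevEDist
  rw [hh, hk, weightedSobolevSeminorm_comp_isometry L₃ Φ₃ hV hUV, weightedSobolevSeminorm_comp_isometry L₃ Φ₃ hV hUV]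

end Distance

/-- **Registered sub-goal `stub_dataWeightedSobolevEDist_comap_sliceReflect`** (crux item stmt-FinalStateConjecture-14985):
the weighted Sobolev data distance is invariant under the reflection of the slice (closed form of
`dataWeightedSobolevEDist_comap_sliceReflect`). [cite: Bartnik1986, (1.2)] -/
theorem stub_dataWeightedSobolevEDist_comap_sliceReflect : ∀ (L : E4 ≃ₗᵢ[ℝ] E4), (∀ (x : E4) (i : Fin 4), L x i = if i = 2 then -x i else x i) → ∀ (L₃ : E3 ≃ₗᵢ[ℝ] E3), (∀ (y : E3) (i : Fin 3), L₃ y i = if i = 1 then -y i else y i) → ∀ (a b r₀ : ℝ), b = -a → ∀ (F : Kerr.slice b r₀ ≃ₜ Kerr.slice a r₀), (∀ y, ((F y : Kerr.slice a r₀) : E3) = L₃ y) → ∀ (hFc : ContMDiff (𝓡 3) (𝓡 3) (∞ + 1) F) (hFi : ∀ u, Function.Injective (mfderiv (𝓡 3) (𝓡 3) F u)) (s : ℕ) (δ : ℝ) (D₁ D₂ : InitialDataSet 𝓘(ℝ, E3) (Kerr.slice a r₀)), InitialDataSet.dataWeightedSobolevEDist s δ (D₁.comap F hFc hFi) (D₂.comap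 F hFc hFi) = InitialDataSet.dataWeightedSobolevEDist s δ D₁ D₂ :=
  fun _ hL _ hL₃ _ _ _ hba _ hF hFc hFi s δ D₁ D₂ ↦
    dataWeightedSobolevEDist_comap_sliceReflect hL hL₃ hF hba hFc hFi s δ D₁ D₂

end Summit.FinalStateConjecture.FinalStateConjecture.Theorems.BulkKerrCaptureC2.Reflection

end
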